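import Literature.AnabelianGeometry.AbsoluteAnabelian.FundamentalExtension
import Summits.ABC.IUTFork.LanaStrips
import Summits.ABC.IUTFork.LanaPadicGalois
import HarnessLib

/-!
# L-LANA objects III bis: the reference local datum at a GOOD `ℚ_p`-place from a profinite extension `1 → Δ → Π → G → 1` (LANA §3.8 (a) (b2))

Record-only file (D-0012) of the abc-iut cell (seat abc-iut-c312-4, L-LANA level; CONSUMES seat
abc-iut-L4-t1's interface `Literature.AnabelianGeometry.AbsoluteAnabelian.FundamentalExtension`); TAKES NO SIDE
on [IUTchIII] Cor. 3.12. LANA §3.8 (a) pp. 20–21: "`Π_v` denotes … (b2) When `v ∈ V^good`, it denotes the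
étale fundamental group `π₁^{ét}` … in either case, there exists a natural surjective homomorphism
`Π_v ↠ G_v`." L4-t1 types exactly this display as `FundamentalExtension` (profinite `arith = Π`, `gal = G`,
continuous surjection `aug`; [AbsTopIII] Thm. 1.9). This file plugs it into `RefLocalDatum` at `K_v = ℚ_p`:
given an extension `E` whose `gal` is identified with `Gal(ℚ̄_p/ℚ_p)` (an isomorphism of topological groups
`e`, the datum "`G_v` equipped with an interpretation as a Galois group"), `RefLocalDatum.ofExtension E e`
is the place datum with `K̄_v = ℚ̄_p` (valuation-preserving, continuous `G_v`-action: `LanaPadicGalois`),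
`Π_v := E.arith` and `Π_v ↠ G_v := e ∘ aug` — so Table 1's `F_v = Π_v ↷ O^▷_v` "determined by the natural
surjection `Π_v ↠ G_v`" (§3.10 p. 22) is CONSTRUCTED for an étale `Π_v` supplied by L4, and the whole
L-LANA stack (`FPrimeStrip`, `HodgeTheater`, `BigH`, …) is available over it. The bad-place (tempered) case
(b1) awaits seat abc-iut-L3-t2's `TemperedArithmeticGroup`, to be plugged in the same way.
[cite: LANA2026Report, §3.8 (a) pp. 20–21, §3.10 p. 22] [cite: MochizukiAbsTopIII2015, Thm 1.9 p.37]
NOT here: any judgement.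
-/

noncomputable section

namespace Summit.ABC
namespace IUTFork

open scoped NNReal
open Literature.AnabelianGeometry.AbsoluteAnabelian

variable (p : ℕ) [Fact p.Prime]

/-- The reference local datum at `K_v = ℚ_p` WITHOUT a fundamental group: `K̄_v = ℚ̄_p`, `| · |`,
`G_v = Gal(ℚ̄_p/ℚ_p)` (Krull topology, isometric continuous action — `LanaPadicGalois`), and — PLACEHOLDER —
`Π_v := G_v`, `Π_v ↠ G_v := id` (only the mono-analytic data `D^⊢_v`, `F^{⊢×}_v`, `F^{⊢×μ}_v` of Table 1 should
be read off it). [cite: LANA2026Report, §3.10 Table 1 p. 22] -/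
@[reducible] def padicRef : RefLocalDatum where
  K := PadicAlgCl p
  Γ₀ := ℝ≥0
  w := padicVal p
  G := PadicGal p
  P := PadicGal p
  ρ := ContinuousMonoidHom.id (PadicGal p)
  ρ_surjective := Function.surjective_id

/-- **§3.8 (a) (b2) at `ℚ_p`, over L4-t1's interface**: the reference local datum with `K̄_v = ℚ̄_p`,
`G_v = Gal(ℚ̄_p/ℚ_p)`, `Π_v := E.arith` (profinite) and `Π_v ↠ G_v := e ∘ E.aug` for a profinite extension
`E : 1 → Δ → Π → G → 1` with `e : E.gal ⥲ Gal(ℚ̄_p/ℚ_p)` ("`G_v` … regarded as a quotient of `Π_v` equipped with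
an interpretation as a fundamental group", §6 (Ind1) p. 31). [cite: LANA2026Report, §3.8 (a) pp. 20–21] -/
@[reducible] def RefLocalDatum.ofExtension (E : FundamentalExtension.{0}) (e : E.gal ≃ₜ* PadicGal p) :
    RefLocalDatum where
  K := PadicAlgCl p
  Γ₀ := ℝ≥0
  w := padicVal p
  G := PadicGal p
  P := E.arith
  ρ := (ContinuousMonoidHom.toContinuousMonoidHom e).comp E.aug
  ρ_surjective := e.surjective.comp E.aug_surjective

/-- The surjection of the constructed datum is `e ∘ aug`. [cite: LANA2026Report, §3.8 (a) p. 21] -/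
theorem RefLocalDatum.ofExtension_ρ_apply (E : FundamentalExtension.{0}) (e : E.gal ≃ₜ* PadicGal p)
    (x : E.arith) : (RefLocalDatum.ofExtension p E e).ρ x = e (E.aug x) := rfl

/-- In `F_v = Π_v ↷ O^▷_{ℚ̄_p}` an element of `Π_v` acts through `e (aug x) ∈ Gal(ℚ̄_p/ℚ_p)`; in particular the
geometric subgroup `Δ = ker aug` (L4-t1 `FundamentalExtension.geom`) acts TRIVIALLY — the Frobenius-like
monoid only sees `G_v` (§3.10: "the action determined by the natural surjection `Π_v ↠ G_v`").
[cite: LANA2026Report, §3.10 p. 22] -/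
theorem RefLocalDatum.ofExtension_geom_acts_trivially (E : FundamentalExtension.{0})
    (e : E.gal ≃ₜ* PadicGal p) (x : (RefLocalDatum.ofExtension p E e).P) (hx : x ∈ E.geom)
    (a : intMonoid (padicVal p)) :
    @HSMul.hSMul _ _ _ (@instHSMul _ _ (RefLocalDatum.ofExtension p E e).holAction.toSMul) x a = a := by
  have hx' : E.aug x = 1 := by
    rw [FundamentalExtension.geom_eq_ker] at hx
    exact hx
  change (e (E.aug x) : PadicGal p) • a = a
  rw [hx', map_one, one_smul]

/-- The five local data of Table 1 at a good `ℚ_p`-place, for an étale `Π_v` supplied by L4-t1's interface: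
e.g. the `F`-prime-strip datum `F_v = Π_v ↷ O^▷_{ℚ̄_p}`. [cite: LANA2026Report, §3.10 Table 1 p. 22] -/
def goodPlaceFhol (E : FundamentalExtension.{0}) (e : E.gal ≃ₜ* PadicGal p) : GMData :=
  (RefLocalDatum.ofExtension p E e).Fhol

/-- … while `F^{⊢×μ}_v = (G_{ℚ_p} ↷ O^{×μ}_{ℚ̄_p}, {I^κ_H})` does not depend on `Π_v` (mono-analytic, "`⊢`"): it is
the one of `padicRef`. [cite: LANA2026Report, §3.10 Table 1 p. 22] -/
theorem goodPlace_FunitMu_eq (E : FundamentalExtension.{0}) (e : E.gal ≃ₜ* PadicGal p) :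
    (RefLocalDatum.ofExtension p E e).FunitMu = (padicRef p).FunitMu := rfl

end IUTFork

end Summit.ABC

end
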